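import Summits.QuantumFields.YangMills.Theorems.BalabanUVNodesN15CovariantLaplacianSpecies
import HarnessLib

/-!
# THE COVARIANT (3.42) ENTRIES OF THE DRESSED PROPAGATOR — `∇_{U′}X` AND `Δ_{U′}X` WITH BAŁABAN's COVARIANT DERIVATIVE AND LAPLACIAN — AS LEFT-DRESSINGS OF THE LINEAGE's PAIR
# COMPONENTS, THEIR IDENTIFICATION, AND THEIR η-DEFECT LETTERS (dag-n15-c g10, FILE 33; Track-A node N15 = NE2, s1 «background-layer OPERATOR ingredient»)

`--kind definition --supports stmt-QuantumFields-20544 --as helper` (K3⁷; count-neutral).  Imports BY NAME this seat's FILE 28 `…CovariantLaplacianSpecies` (`covLapM`, `speciesOpM`, `tCoefA`,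
`tCoefC`, `covLapM_eq_one_sub_speciesOpM`, `fdiffN_liftMap_eq_fgrad`, `mmulOp_smul`; through it M1 `bgPairM`, `projO_none_bgPairM`, `projO_some_bgPairM`, `unstackM`, n15-b `bgPropV_fix`, `stack`,
`projO`, `bgDerivedV`, `covD`, `mmulOp`, `hasMaj_mmulOp`, `hasMaj_idef_mmulOp`, FILE 1 `fgrad` ∕ `bgrad`, FILE 18 `mmulOp_add`, FILE 12 `mmulOp_sub`, [B11] `HasMaj`, `hasMaj_comp`,
`T4EtaRateDefect.idef`, `idef_comp`); nothing in the tree is modified.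

WHY.  [Balaban1985BackgroundPropagators] Thm 3.1 (3.42) p. 397 bounds `|G(U)λ|`, `|∇_U G(U)λ|`, `|G(U)∇*_U λ|`, `|Δ_U G(U)λ|` with the COVARIANT derivative and Laplacian of the
background.  Every operator-layer family of this lineage so far reads entries 1 and 3 with the FLAT quotients `∇_μX`, `Δ_1X` of the dressed propagator `X` (model-level).  By FILE 28
(`covD`, (3.53)) the covariant entries at `U′ = e^{iηA}` are LEFT-DRESSINGS of the pair's own components by the coefficient fields — `∇_{U′,ν}X = M_{1+ηa⁺_ν}∘(∇_νX) + M_{a⁺_ν}∘X`,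
`Δ_{U′}X = Δ_1X − [M_cX + Σ_μ(M_{a⁺_μ}∇⁺_μX + M_{a⁻_μ}∇⁻_μX)]` — so their η-defects follow from the lineage's letters (component defects, coefficient rows and fits) by the Leibniz rule
`𝔇(M′E′, ME) = M′𝔇(E′,E) + 𝔇(M′,M)E` with DIAGONAL left factors.  This file types the two covariant entries over M1's pair, identifies them, and proves their defect letters; the
sequel packages them into a kernel family and `NE2PlusOperator`.

WHAT.  §1 ★ `hasMaj_idef_mmulOp_comp_left` (the diagonal Leibniz letter: rows `α`, fit `o`, `𝔇(E′,E) ≤ m·e^{−ρd}`, `E ≤ β_E·e^{−ρd}` ⟹ `𝔇(M′E′, ME) ≤ (αm + oβ_E)e^{−ρd}`), `hasMaj_mmulOp_comp_left'`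
(`M′E′ ≤ αβ e^{−ρd}`).  §2 defs `dressedV` (`V∘X` expanded on the components: `M_CX + Σ_μ[M_{A⁺_μ}X⁺_μ + M_{A⁻_μ}X⁻_μ]`), `covEntry1` (`M_{1+ηA⁺_ν}X⁺_ν + M_{A⁺_ν}X`), `covEntry3`
(`E₃ − dressedV`); identifications ★ `speciesOpM_comp_dressed_eq_dressedV`, ★ `covD_comp_dressed_eq_covEntry1` (`covD η (1+ηA⁺_ν) τ_ν ∘ X = covEntry1`, `η ≠ 0`), ★★
`covLapM_comp_dressed_eq_covEntry3` (`Δ_R∘X = covEntry3` for ANY transports `R` with `(C, A) = (tCoefC, tCoefA)(R)`, given `D₃ = Δ_1∘G`).  §3 ★★ `hasMaj_idef_covEntry1`, ★★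
`hasMaj_idef_covEntry3` (the η-defect letters of the two covariant entries from: component defects `≤ m₁e^{−ρd}` (all `Option (J ⊕ J)` components), coarse component majorants `≤ β_Xe^{−ρd}`,
the flat entry-3 defect `≤ m₃e^{−ρd}`, coefficient rows `≤ a`, fits `≤ o`, transport fit `≤ o_R`).

HONEST FRAMING.  Algebra + block-majorant bookkeeping over the lineage's objects; the letters are hypotheses here (discharged on the torus family in the sequel); entry 2 (`X∇*_U`) is NOT
made covariant here (the flat by-parts `X∇*` stays; `X∘D*_{U′} − X∇*` = `X∘(diag∘shift)` terms — located); `U ≡ 1` chart; `DRD*`, `aQ*Q` at `U ≡ 1`; NE2⁺ NOT PRINTED; count-neutral; N15 NOT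
discharged; one finite torus at fixed ε — NOT ℝ⁴, NOT infinite volume, NOT OS, NOT a mass gap, NOT Clay.
-/

noncomputable section

open scoped BigOperators
open Finset

namespace Summit.QuantumFields.YangMills.BalabanUVNodes.N15.BackgroundLayer

open Literature.MathematicalPhysics.QuantumFieldTheory.Balaban1983to89
open Literature.MathematicalPhysics.QuantumFieldTheory.Balaban1983to89.B11SectG (BlockNorm HasMaj hasMaj_comp)
open Literature.MathematicalPhysics.QuantumFieldTheory.Balaban1983to89.T4EtaRateDefect (idef idef_apply idef_comp idef_add idef_sub)
open Literature.MathematicalPhysics.QuantumFieldTheory.Balaban1983to89.T4EtaRateCoeffDefect (pull pull_apply diagK diagK_nonneg)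
open Summit.QuantumFields.YangMills.BalabanUVNodes.N15.DerivDefect (fdiffN sum_diagK_mul sum_mul_diagK hasMaj_finset_sum)
open Summit.QuantumFields.YangMills.BalabanUVNodes.N15.MatrixSpecies (mmulOp mmulOp_apply liftMap liftBlk liftEquiv covD hasMaj_mmulOp hasMaj_idef_mmulOp)

/-! ## §1 The diagonal Leibniz letter -/

section Leibniz

variable {X X' ι : Type} [Fintype X] [Fintype X'] [Fintype ι] [DecidableEq ι] {g : B6.Geometry} (blk : X → g.Site) (π : X' → X)

omit [Fintype X] [DecidableEq ι] in
/-- `M_{C′}∘E′ ≤ α·β·e^{−ρd}` from rows `≤ α` and `E′ ≤ βe^{−ρd}` (fine carrier). [folklore] -/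
theorem hasMaj_mmulOp_comp_left' {C' : X' → Matrix ι ι ℝ} {E' : (X' × ι → ℝ) →ₗ[ℝ] (X' × ι → ℝ)} {α β ρ : ℝ} (hα : 0 ≤ α)
    (hC' : ∀ x' i, ∑ j, |C' x' i j| ≤ α) (hE' : HasMaj (BlockNorm.ofBlocks g (liftBlk (blk ∘ π) ι)) (BlockNorm.ofBlocks g (liftBlk (blk ∘ π) ι)) E' (fun y y' => β * Real.exp (-(ρ * g.dist y y')))) :
    HasMaj (BlockNorm.ofBlocks g (liftBlk (blk ∘ π) ι)) (BlockNorm.ofBlocks g (liftBlk (blk ∘ π) ι)) (mmulOp C' ∘ₗ E') (fun y y' => α * β * Real.exp (-(ρ * g.dist y y'))) := by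
  have hM := hasMaj_mmulOp (g := g) (blk ∘ π) (m := fun _ => α) (fun _ => hα) hC'
  refine (hasMaj_comp hM hE' fun _ _ => diagK_nonneg (fun _ => hα) _ _).mono fun y y' => le_of_eq ?_
  have hκ : (BlockNorm.ofBlocks g (liftBlk (blk ∘ π) ι)).κ = 1 := rfl
  simp only [hκ, one_mul]
  rw [sum_diagK_mul]
  ring

omit [DecidableEq ι] in
/-- ★ **THE DIAGONAL LEIBNIZ LETTER**: `𝔇(M_{C′}E′, M_CE) = M_{C′}𝔇(E′,E) + 𝔇(M_{C′},M_C)E ≤ (αm + oβ_E)e^{−ρd}` from the rows `≤ α` of `C′`, the row fit `≤ o` of `C′ − C∘π`, the component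
defect `𝔇(E′,E) ≤ me^{−ρd}` and the coarse majorant `E ≤ β_Ee^{−ρd}` (`T4EtaRateDefect.idef_comp`, n15-b `hasMaj_mmulOp` ∕ `hasMaj_idef_mmulOp`, [B11] `hasMaj_comp`).
[cite: Balaban1984PropagatorsII, (2.52)–(2.55) p.232 (composition of majorants)] -/
theorem hasMaj_idef_mmulOp_comp_left {C' : X' → Matrix ι ι ℝ} {C : X → Matrix ι ι ℝ} {E' : (X' × ι → ℝ) →ₗ[ℝ] (X' × ι → ℝ)} {E : (X × ι → ℝ) →ₗ[ℝ] (X × ι → ℝ)}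
    {α o m βE ρ : ℝ} (hα : 0 ≤ α) (ho : 0 ≤ o) (hC' : ∀ x' i, ∑ j, |C' x' i j| ≤ α) (hfit : ∀ x' i, ∑ j, |C' x' i j - C (π x') i j| ≤ o)
    (hDE : HasMaj (BlockNorm.ofBlocks g (liftBlk blk ι)) (BlockNorm.ofBlocks g (liftBlk (blk ∘ π) ι)) (idef (pull (liftMap π ι)) (pull (liftMap π ι)) E' E)
      (fun y y' => m * Real.exp (-(ρ * g.dist y y'))))
    (hE : HasMaj (BlockNorm.ofBlocks g (liftBlk blk ι)) (BlockNorm.ofBlocks g (liftBlk blk ι)) E (fun y y' => βE * Real.exp (-(ρ * g.dist y y')))) :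
    HasMaj (BlockNorm.ofBlocks g (liftBlk blk ι)) (BlockNorm.ofBlocks g (liftBlk (blk ∘ π) ι))
      (idef (pull (liftMap π ι)) (pull (liftMap π ι)) (mmulOp C' ∘ₗ E') (mmulOp C ∘ₗ E)) (fun y y' => (α * m + o * βE) * Real.exp (-(ρ * g.dist y y'))) := by
  rw [idef_comp (pull (liftMap π ι)) (pull (liftMap π ι)) (pull (liftMap π ι))]
  have hM' := hasMaj_mmulOp (g := g) (blk ∘ π) (m := fun _ => α) (fun _ => hα) hC'
  have hDM := hasMaj_idef_mmulOp (g := g) (ι := ι) blk π (o := fun _ => o) (fun _ => ho) hfit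
  have h1 := hasMaj_comp hM' hDE fun _ _ => diagK_nonneg (fun _ => hα) _ _
  have h2 := hasMaj_comp hDM hE fun _ _ => diagK_nonneg (fun _ => ho) _ _
  refine (h1.add h2).mono fun y y' => le_of_eq ?_
  have hκ1 : (BlockNorm.ofBlocks g (liftBlk (blk ∘ π) ι)).κ = 1 := rfl
  have hκ2 : (BlockNorm.ofBlocks g (liftBlk blk ι)).κ = 1 := rfl
  simp only [hκ1, hκ2, one_mul]
  rw [sum_diagK_mul, sum_diagK_mul]
  ring

/-- Finite sums: `𝔇(Σ T′_k, Σ T_k) = Σ 𝔇(T′_k, T_k)`. [folklore] -/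
theorem idef_finset_sum {F₁ F₂ F₁' F₂' K : Type} [AddCommGroup F₁] [Module ℝ F₁] [AddCommGroup F₂] [Module ℝ F₂] [AddCommGroup F₁'] [Module ℝ F₁']
    [AddCommGroup F₂'] [Module ℝ F₂'] (τ₁ : F₁ →ₗ[ℝ] F₁') (τ₂ : F₂ →ₗ[ℝ] F₂') (s : Finset K) (T' : K → F₁' →ₗ[ℝ] F₂') (T : K → F₁ →ₗ[ℝ] F₂) :
    idef τ₁ τ₂ (∑ k ∈ s, T' k) (∑ k ∈ s, T k) = ∑ k ∈ s, idef τ₁ τ₂ (T' k) (T k) := by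
  classical
  induction s using Finset.induction_on with
  | empty => simp [idef]
  | insert k s hk ih => rw [Finset.sum_insert hk, Finset.sum_insert hk, Finset.sum_insert hk, idef_add, ih]

end Leibniz

/-! ## §2 The covariant entries as left-dressings of the pair components, and their identification -/

section Entries

variable {X J ι : Type} [Fintype X] [Fintype J] [Fintype ι] [DecidableEq X] [DecidableEq J] [DecidableEq ι] (τ : J → X ≃ X)

/-- `V∘X` EXPANDED ON THE PAIR COMPONENTS: `M_CX + Σ_μ[M_{A⁺_μ}X⁺_μ + M_{A⁻_μ}X⁻_μ]`, `X = pr₀X̂`, `X^±_μ = pr_{±μ}X̂` (the forward ∕ backward quotients of the dressed propagator).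
[cite: Balaban1985BackgroundPropagators, (3.52)–(3.53) p.400 (V′₁(A) applied to G(U′U): shape)] -/
def dressedV (G : (X × ι → ℝ) →ₗ[ℝ] (X × ι → ℝ)) (D : J ⊕ J → (X × ι → ℝ) →ₗ[ℝ] (X × ι → ℝ)) (C : X → Matrix ι ι ℝ) (A : J ⊕ J → X → Matrix ι ι ℝ) :
    (X × ι → ℝ) →ₗ[ℝ] (X × ι → ℝ) :=
  mmulOp C ∘ₗ (projO none ∘ₗ bgPairM G D C A) +
    ∑ μ, (mmulOp (A (Sum.inl μ)) ∘ₗ (projO (some (Sum.inl μ)) ∘ₗ bgPairM G D C A) + mmulOp (A (Sum.inr μ)) ∘ₗ (projO (some (Sum.inr μ)) ∘ₗ bgPairM G D C A))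

/-- **THE COVARIANT ENTRY 1** `∇_{U′,ν}X = M_{1+ηA⁺_ν}∘X⁺_ν + M_{A⁺_ν}∘X` — Bałaban's covariant derivative `D^η_{R,τ_ν}` (transport `R⁺_ν = 1 + ηa⁺_ν`) of the dressed propagator, written on
the pair components. [cite: Balaban1985BackgroundPropagators, (3.42) p.397 (entry «∇_U G(U)λ») + (3.50) p.400] -/
def covEntry1 (η : ℝ) (G : (X × ι → ℝ) →ₗ[ℝ] (X × ι → ℝ)) (D : J ⊕ J → (X × ι → ℝ) →ₗ[ℝ] (X × ι → ℝ)) (C : X → Matrix ι ι ℝ) (A : J ⊕ J → X → Matrix ι ι ℝ) (ν : J) :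
    (X × ι → ℝ) →ₗ[ℝ] (X × ι → ℝ) :=
  mmulOp (fun x => 1 + η • A (Sum.inl ν) x) ∘ₗ (projO (some (Sum.inl ν)) ∘ₗ bgPairM G D C A) + mmulOp (A (Sum.inl ν)) ∘ₗ (projO none ∘ₗ bgPairM G D C A)

/-- **THE COVARIANT ENTRY 3** `Δ_{U′}X = Δ_1X − V∘X` on the pair components: n15-b's flat derived entry `bgDerivedV Ĝ D₃ V̂` (`= Δ_1X` when `D₃ = Δ_1G`) minus `dressedV`.
[cite: Balaban1985BackgroundPropagators, (3.42) p.397 (entry «Δ_U G(U)λ») + (3.53) p.400] -/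
def covEntry3 (G D₃ : (X × ι → ℝ) →ₗ[ℝ] (X × ι → ℝ)) (D : J ⊕ J → (X × ι → ℝ) →ₗ[ℝ] (X × ι → ℝ)) (C : X → Matrix ι ι ℝ) (A : J ⊕ J → X → Matrix ι ι ℝ) :
    (X × ι → ℝ) →ₗ[ℝ] (X × ι → ℝ) :=
  bgDerivedV (stack G D) D₃ (unstackM C A) - dressedV G D C A

variable (n : ℝ) (G : (X × ι → ℝ) →ₗ[ℝ] (X × ι → ℝ)) {D : J ⊕ J → (X × ι → ℝ) →ₗ[ℝ] (X × ι → ℝ)} (C : X → Matrix ι ι ℝ) (A : J ⊕ J → X → Matrix ι ι ℝ)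

/-- The forward quotient of the dressed propagator IS the forward component of the pair: `∇⁺_μ∘X = X⁺_μ`. [cite: Balaban1985BackgroundPropagators, (3.65) p.402 (mechanism)] -/
theorem fgrad_comp_dressed_eq (hDf : ∀ μ, D (Sum.inl μ) = fgrad n (liftEquiv (τ μ) ι) ∘ₗ G) (hunit : IsUnit (1 - LinearMap.toMatrix' (stack G D ∘ₗ unstackM C A))) (μ : J) :
    fgrad n (liftEquiv (τ μ) ι) ∘ₗ (projO none ∘ₗ bgPairM G D C A) = projO (some (Sum.inl μ)) ∘ₗ bgPairM G D C A := by
  rw [projO_none_bgPairM hunit, projO_some_bgPairM hunit, LinearMap.comp_add, ← LinearMap.comp_assoc, ← hDf]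

/-- … and the backward quotient IS the backward component: `∇⁻_μ∘X = X⁻_μ`. [cite: Balaban1985BackgroundPropagators, (3.65) p.402 (mechanism)] -/
theorem bgrad_comp_dressed_eq (hDb : ∀ μ, D (Sum.inr μ) = bgrad n (liftEquiv (τ μ) ι) ∘ₗ G) (hunit : IsUnit (1 - LinearMap.toMatrix' (stack G D ∘ₗ unstackM C A))) (μ : J) :
    bgrad n (liftEquiv (τ μ) ι) ∘ₗ (projO none ∘ₗ bgPairM G D C A) = projO (some (Sum.inr μ)) ∘ₗ bgPairM G D C A := by
  rw [projO_none_bgPairM hunit, projO_some_bgPairM hunit, LinearMap.comp_add, ← LinearMap.comp_assoc, ← hDb]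

/-- ★ `V∘X = dressedV`: the species operator applied to the dressed propagator, expanded on the components. [cite: Balaban1985BackgroundPropagators, (3.52) p.400 (shape)] -/
theorem speciesOpM_comp_dressed_eq_dressedV (hDf : ∀ μ, D (Sum.inl μ) = fgrad n (liftEquiv (τ μ) ι) ∘ₗ G) (hDb : ∀ μ, D (Sum.inr μ) = bgrad n (liftEquiv (τ μ) ι) ∘ₗ G)
    (hunit : IsUnit (1 - LinearMap.toMatrix' (stack G D ∘ₗ unstackM C A))) :
    speciesOpM τ n C A ∘ₗ (projO none ∘ₗ bgPairM G D C A) = dressedV G D C A := by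
  rw [speciesOpM, dressedV, LinearMap.add_comp, linearMap_sum_comp]
  congr 1
  refine Finset.sum_congr rfl fun μ _ => ?_
  rw [LinearMap.add_comp, LinearMap.comp_assoc, LinearMap.comp_assoc, fgrad_comp_dressed_eq τ n G C A hDf hunit, bgrad_comp_dressed_eq τ n G C A hDb hunit]

/-- ★ **`D^η_{1+ηA⁺_ν, τ_ν}∘X = covEntry1`**: n15-b's covariant derivative with the transport `R⁺_ν = 1 + ηA⁺_ν` applied to the dressed propagator IS the covariant entry 1 (`η = n⁻¹ ≠ 0`;
`covD = M_R∘∇ + M_{η⁻¹(R−1)}`, `∇∘X = X⁺_ν`). [cite: Balaban1985BackgroundPropagators, (3.50) p.400] -/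
theorem covD_comp_dressed_eq_covEntry1 (hn : n ≠ 0) (hDf : ∀ μ, D (Sum.inl μ) = fgrad n (liftEquiv (τ μ) ι) ∘ₗ G)
    (hunit : IsUnit (1 - LinearMap.toMatrix' (stack G D ∘ₗ unstackM C A))) (ν : J) :
    covD n⁻¹ (fun x => 1 + n⁻¹ • A (Sum.inl ν) x) (τ ν) ∘ₗ (projO none ∘ₗ bgPairM G D C A) = covEntry1 n⁻¹ G D C A ν := by
  have hcoef : (fun x => (n⁻¹)⁻¹ • ((1 + n⁻¹ • A (Sum.inl ν) x) - 1)) = A (Sum.inl ν) := by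
    funext x
    rw [add_sub_cancel_left, smul_smul, inv_inv, mul_inv_cancel₀ hn, one_smul]
  rw [covD, hcoef, fdiffN_liftMap_eq_fgrad, inv_inv, LinearMap.add_comp, LinearMap.comp_assoc, fgrad_comp_dressed_eq τ n G C A hDf hunit ν, covEntry1]

/-- ★★ **`Δ_R∘X = covEntry3` FOR ARBITRARY TRANSPORTS**: with the exact coefficients `(C, A) = (tCoefC, tCoefA)(R)` of FILE 28 and the Laplacian piece `D₃ = Δ_1∘G`, Bałaban's
covariant Laplacian of the transports `R` applied to the dressed propagator IS the covariant entry 3 (FILE 28 (3.53) `Δ_R = Δ_1 − V`, `Δ_1∘X = bgDerivedV` since `X = G(1 + V̂X̂)`, and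
`V∘X = dressedV`). [cite: Balaban1985BackgroundPropagators, (3.50)–(3.53) p.400, (3.64)–(3.65) p.402] -/
theorem covLapM_comp_dressed_eq_covEntry3 (η : ℝ) (R : J ⊕ J → X → Matrix ι ι ℝ) {D₃ : (X × ι → ℝ) →ₗ[ℝ] (X × ι → ℝ)}
    (hD₃ : D₃ = covLapM (ι := ι) τ η (fun _ _ => 1) ∘ₗ G)
    (hDf : ∀ μ, D (Sum.inl μ) = fgrad η⁻¹ (liftEquiv (τ μ) ι) ∘ₗ G) (hDb : ∀ μ, D (Sum.inr μ) = bgrad η⁻¹ (liftEquiv (τ μ) ι) ∘ₗ G)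
    (hunit : IsUnit (1 - LinearMap.toMatrix' (stack G D ∘ₗ unstackM (tCoefC η R) (tCoefA η R)))) :
    covLapM τ η R ∘ₗ (projO none ∘ₗ bgPairM G D (tCoefC η R) (tCoefA η R)) = covEntry3 G D₃ D (tCoefC η R) (tCoefA η R) := by
  have hX : projO none ∘ₗ bgPairM G D (tCoefC η R) (tCoefA η R) = G + G ∘ₗ (unstackM (tCoefC η R) (tCoefA η R) ∘ₗ bgPairM G D (tCoefC η R) (tCoefA η R)) :=
    projO_none_bgPairM hunit
  have h3 : bgDerivedV (stack G D) D₃ (unstackM (tCoefC η R) (tCoefA η R)) = covLapM (ι := ι) τ η (fun _ _ => 1) ∘ₗ (projO none ∘ₗ bgPairM G D (tCoefC η R) (tCoefA η R)) := by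
    rw [bgDerivedV, hX, hD₃, LinearMap.comp_add, LinearMap.comp_assoc, LinearMap.comp_assoc]
    rfl
  rw [covLapM_eq_one_sub_speciesOpM τ η R, LinearMap.sub_comp, covEntry3, h3, speciesOpM_comp_dressed_eq_dressedV τ η⁻¹ G _ _ hDf hDb hunit]

end Entries

/-! ## §3 The η-defect letters of the two covariant entries -/

section Letters

variable {X X' J ι : Type} [Fintype X] [Fintype X'] [Fintype J] [Fintype ι] [DecidableEq X] [DecidableEq X'] [DecidableEq J] [DecidableEq ι]
  {g : B6.Geometry} (blk : X → g.Site) (π : X' → X)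
  {G : (X × ι → ℝ) →ₗ[ℝ] (X × ι → ℝ)} {D : J ⊕ J → (X × ι → ℝ) →ₗ[ℝ] (X × ι → ℝ)} {D₃ : (X × ι → ℝ) →ₗ[ℝ] (X × ι → ℝ)}
  {G' : (X' × ι → ℝ) →ₗ[ℝ] (X' × ι → ℝ)} {D' : J ⊕ J → (X' × ι → ℝ) →ₗ[ℝ] (X' × ι → ℝ)} {D₃' : (X' × ι → ℝ) →ₗ[ℝ] (X' × ι → ℝ)}
  {C : X → Matrix ι ι ℝ} {A : J ⊕ J → X → Matrix ι ι ℝ} {C' : X' → Matrix ι ι ℝ} {A' : J ⊕ J → X' → Matrix ι ι ℝ}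
  {η η' a o oR m₁ m₃ βX ρ : ℝ}

/-- ★★ **THE η-DEFECT OF THE COVARIANT ENTRY 1**: from the component defects `𝔇(X′_j, X_j) ≤ m₁e^{−ρd}` (`j = none, +ν`), the coarse component majorants `≤ β_Xe^{−ρd}`, the rows `≤ a`
of `A′⁺_ν` (hence `≤ 1 + a` of `1 + η′A′⁺_ν` for `0 ≤ η′ ≤ 1`), the fit `≤ o` of `A⁺_ν`, and the TRANSPORT FIT `Σ_j|(1 + η′A′⁺_ν(x′)) − (1 + ηA⁺_ν(πx′))|_{ij} ≤ o_R`: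
`𝔇(covEntry1′, covEntry1) ≤ ((1 + a)m₁ + o_Rβ_X + am₁ + oβ_X)·e^{−ρd}` (§1 twice). [cite: Balaban1985BackgroundPropagators, (3.42) p.397 + (3.50) p.400 (shapes); Balaban1984PropagatorsII, (2.52)–(2.55) p.232] -/
theorem hasMaj_idef_covEntry1 (hη'0 : 0 ≤ η') (hη'1 : η' ≤ 1) (ha : 0 ≤ a) (ho : 0 ≤ o) (hoR : 0 ≤ oR) (ν : J)
    (hA' : ∀ x' i, ∑ j, |A' (Sum.inl ν) x' i j| ≤ a) (hfA : ∀ x' i, ∑ j, |A' (Sum.inl ν) x' i j - A (Sum.inl ν) (π x') i j| ≤ o)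
    (hfR : ∀ x' i, ∑ j, |(1 + η' • A' (Sum.inl ν) x') i j - (1 + η • A (Sum.inl ν) (π x')) i j| ≤ oR)
    (hD0 : HasMaj (BlockNorm.ofBlocks g (liftBlk blk ι)) (BlockNorm.ofBlocks g (liftBlk (blk ∘ π) ι))
      (idef (pull (liftMap π ι)) (pull (liftMap π ι)) (projO none ∘ₗ bgPairM G' D' C' A') (projO none ∘ₗ bgPairM G D C A)) (fun y y' => m₁ * Real.exp (-(ρ * g.dist y y'))))
    (hD1 : HasMaj (BlockNorm.ofBlocks g (liftBlk blk ι)) (BlockNorm.ofBlocks g (liftBlk (blk ∘ π) ι))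
      (idef (pull (liftMap π ι)) (pull (liftMap π ι)) (projO (some (Sum.inl ν)) ∘ₗ bgPairM G' D' C' A') (projO (some (Sum.inl ν)) ∘ₗ bgPairM G D C A))
      (fun y y' => m₁ * Real.exp (-(ρ * g.dist y y'))))
    (hX0 : HasMaj (BlockNorm.ofBlocks g (liftBlk blk ι)) (BlockNorm.ofBlocks g (liftBlk blk ι)) (projO none ∘ₗ bgPairM G D C A) (fun y y' => βX * Real.exp (-(ρ * g.dist y y'))))
    (hX1 : HasMaj (BlockNorm.ofBlocks g (liftBlk blk ι)) (BlockNorm.ofBlocks g (liftBlk blk ι)) (projO (some (Sum.inl ν)) ∘ₗ bgPairM G D C A)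
      (fun y y' => βX * Real.exp (-(ρ * g.dist y y')))) :
    HasMaj (BlockNorm.ofBlocks g (liftBlk blk ι)) (BlockNorm.ofBlocks g (liftBlk (blk ∘ π) ι))
      (idef (pull (liftMap π ι)) (pull (liftMap π ι)) (covEntry1 η' G' D' C' A' ν) (covEntry1 η G D C A ν))
      (fun y y' => ((1 + a) * m₁ + oR * βX + (a * m₁ + o * βX)) * Real.exp (-(ρ * g.dist y y'))) := by
  have hR' : ∀ x' i, ∑ j, |(fun x' => 1 + η' • A' (Sum.inl ν) x') x' i j| ≤ 1 + a := by
    intro x' i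
    calc ∑ j, |(1 + η' • A' (Sum.inl ν) x') i j| ≤ ∑ j, (|(1 : Matrix ι ι ℝ) i j| + η' * |A' (Sum.inl ν) x' i j|) := Finset.sum_le_sum fun j _ => by
            rw [Matrix.add_apply, Matrix.smul_apply, smul_eq_mul]
            refine (abs_add_le _ _).trans (le_of_eq ?_)
            rw [abs_mul, abs_of_nonneg hη'0]
      _ = ∑ j, |(1 : Matrix ι ι ℝ) i j| + η' * ∑ j, |A' (Sum.inl ν) x' i j| := by rw [Finset.sum_add_distrib, Finset.mul_sum]
      _ ≤ 1 + 1 * a := by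
          refine add_le_add (le_of_eq ?_) (mul_le_mul hη'1 (hA' x' i) (Finset.sum_nonneg fun _ _ => abs_nonneg _) zero_le_one)
          simp only [Matrix.one_apply]
          rw [Finset.sum_eq_single i (fun j _ hj => by rw [if_neg (Ne.symm hj), abs_zero]) (fun h => absurd (Finset.mem_univ i) h), if_pos rfl, abs_one]
      _ = 1 + a := by ring
  have h1 := hasMaj_idef_mmulOp_comp_left blk π (C := fun x => 1 + η • A (Sum.inl ν) x) (by linarith) hoR hR' hfR hD1 hX1
  have h2 := hasMaj_idef_mmulOp_comp_left blk π ha ho hA' hfA hD0 hX0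
  rw [covEntry1, covEntry1, idef_add]
  refine (h1.add h2).mono fun y y' => le_of_eq ?_
  ring

/-- ★★ **THE η-DEFECT OF THE COVARIANT ENTRY 3**: from the flat entry-3 defect `≤ m₃e^{−ρd}`, the component defects `≤ m₁e^{−ρd}` (components `none`, `±μ` for every `μ`), the coarse
component majorants `≤ β_Xe^{−ρd}`, the rows `≤ a` of `C′, A′^±_μ` and the fits `≤ o` of `C, A^±_μ`:
`𝔇(covEntry3′, covEntry3) ≤ (m₃ + (1 + 2|J|)(am₁ + oβ_X))·e^{−ρd}` (§1 once per term). [cite: Balaban1985BackgroundPropagators, (3.42) p.397 + (3.53) p.400 (shapes); Balaban1984PropagatorsII, (2.52)–(2.55) p.232] -/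
theorem hasMaj_idef_covEntry3 (ha : 0 ≤ a) (ho : 0 ≤ o)
    (hC' : ∀ x' i, ∑ j, |C' x' i j| ≤ a) (hA' : ∀ μ x' i, ∑ j, |A' μ x' i j| ≤ a) (hfC : ∀ x' i, ∑ j, |C' x' i j - C (π x') i j| ≤ o)
    (hfA : ∀ μ x' i, ∑ j, |A' μ x' i j - A μ (π x') i j| ≤ o)
    (hDj : ∀ j : Option (J ⊕ J), HasMaj (BlockNorm.ofBlocks g (liftBlk blk ι)) (BlockNorm.ofBlocks g (liftBlk (blk ∘ π) ι))
      (idef (pull (liftMap π ι)) (pull (liftMap π ι)) (projO j ∘ₗ bgPairM G' D' C' A') (projO j ∘ₗ bgPairM G D C A)) (fun y y' => m₁ * Real.exp (-(ρ * g.dist y y'))))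
    (hXj : ∀ j : Option (J ⊕ J), HasMaj (BlockNorm.ofBlocks g (liftBlk blk ι)) (BlockNorm.ofBlocks g (liftBlk blk ι)) (projO j ∘ₗ bgPairM G D C A)
      (fun y y' => βX * Real.exp (-(ρ * g.dist y y'))))
    (hD3 : HasMaj (BlockNorm.ofBlocks g (liftBlk blk ι)) (BlockNorm.ofBlocks g (liftBlk (blk ∘ π) ι))
      (idef (pull (liftMap π ι)) (pull (liftMap π ι)) (bgDerivedV (stack G' D') D₃' (unstackM C' A')) (bgDerivedV (stack G D) D₃ (unstackM C A)))
      (fun y y' => m₃ * Real.exp (-(ρ * g.dist y y')))) :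
    HasMaj (BlockNorm.ofBlocks g (liftBlk blk ι)) (BlockNorm.ofBlocks g (liftBlk (blk ∘ π) ι))
      (idef (pull (liftMap π ι)) (pull (liftMap π ι)) (covEntry3 G' D₃' D' C' A') (covEntry3 G D₃ D C A))
      (fun y y' => (m₃ + (1 + 2 * Fintype.card J) * (a * m₁ + o * βX)) * Real.exp (-(ρ * g.dist y y'))) := by
  have hterm : ∀ (Cf : X' → Matrix ι ι ℝ) (Cc : X → Matrix ι ι ℝ) (j : Option (J ⊕ J)), (∀ x' i, ∑ k, |Cf x' i k| ≤ a) → (∀ x' i, ∑ k, |Cf x' i k - Cc (π x') i k| ≤ o) →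
      HasMaj (BlockNorm.ofBlocks g (liftBlk blk ι)) (BlockNorm.ofBlocks g (liftBlk (blk ∘ π) ι))
        (idef (pull (liftMap π ι)) (pull (liftMap π ι)) (mmulOp Cf ∘ₗ (projO j ∘ₗ bgPairM G' D' C' A')) (mmulOp Cc ∘ₗ (projO j ∘ₗ bgPairM G D C A)))
        (fun y y' => (a * m₁ + o * βX) * Real.exp (-(ρ * g.dist y y'))) :=
    fun Cf Cc j hr hf => hasMaj_idef_mmulOp_comp_left blk π ha ho hr hf (hDj j) (hXj j)
  have hV : HasMaj (BlockNorm.ofBlocks g (liftBlk blk ι)) (BlockNorm.ofBlocks g (liftBlk (blk ∘ π) ι))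
      (idef (pull (liftMap π ι)) (pull (liftMap π ι)) (dressedV G' D' C' A') (dressedV G D C A))
      (fun y y' => (1 + 2 * Fintype.card J) * (a * m₁ + o * βX) * Real.exp (-(ρ * g.dist y y'))) := by
    rw [dressedV, dressedV, idef_add, idef_finset_sum]
    have hsum := hasMaj_finset_sum (b₁ := BlockNorm.ofBlocks g (liftBlk blk ι)) (b₂ := BlockNorm.ofBlocks g (liftBlk (blk ∘ π) ι)) Finset.univ
      (T := fun μ => idef (pull (liftMap π ι)) (pull (liftMap π ι))
        (mmulOp (A' (Sum.inl μ)) ∘ₗ (projO (some (Sum.inl μ)) ∘ₗ bgPairM G' D' C' A') + mmulOp (A' (Sum.inr μ)) ∘ₗ (projO (some (Sum.inr μ)) ∘ₗ bgPairM G' D' C' A'))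
        (mmulOp (A (Sum.inl μ)) ∘ₗ (projO (some (Sum.inl μ)) ∘ₗ bgPairM G D C A) + mmulOp (A (Sum.inr μ)) ∘ₗ (projO (some (Sum.inr μ)) ∘ₗ bgPairM G D C A)))
      (K := fun _ y y' => (a * m₁ + o * βX) * Real.exp (-(ρ * g.dist y y')) + (a * m₁ + o * βX) * Real.exp (-(ρ * g.dist y y')))
      (fun μ _ => by
        rw [idef_add]
        exact (hterm _ _ _ (hA' (Sum.inl μ)) (hfA (Sum.inl μ))).add (hterm _ _ _ (hA' (Sum.inr μ)) (hfA (Sum.inr μ))))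
    refine ((hterm C' C none hC' hfC).add hsum).mono fun y y' => le_of_eq ?_
    simp only [Finset.sum_const, Finset.card_univ, nsmul_eq_mul]
    ring
  rw [covEntry3, covEntry3, idef_sub]
  refine (hD3.sub hV).mono fun y y' => le_of_eq ?_
  ring

end Letters

end Summit.QuantumFields.YangMills.BalabanUVNodes.N15.BackgroundLayer

end
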